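/-
Origin: expansion seat `planner-pub-hodgecm-pv10-g4-0`, handover #7 2026-08-18T11:37:54Z (`HOME/pub-hodgecm-pv10-g4/lean/Pv10g4/ShimuraSetDecomposition.lean`, md5 7b0692b9, 409 lines);
landed by the gen-8 packager in gate run 29 as `HodgeCM/PerL34/ShimuraSetDecomposition.lean` (import ^import Pv[0-9]+g[0-9]+\.→import HodgeCM.PerL34. ×2; stripped 3 #print/#check/#eval lines).
-/
/-
Origin: pub-hodgecm cell, seat pv10-g4 (unit `pub-hodgecm-pv10-g4`, DAG-node prover #10, gen 4), 2026-08-18.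
WIP module `Pv10g4.ShimuraSetDecomposition`; intended landing place `HodgeCM/PerL34/ShimuraSetDecomposition.lean`
(import rewrites on landing: `import Pv10g4.UnitaryClassNumber` ↦ `import HodgeCM.PerL34.UnitaryClassNumber`,
`import Pv10g4.CongruenceLattice` ↦ `import HodgeCM.PerL34.CongruenceLattice`).
-/
import Summits.HodgeConjecture.HodgeCM.PerL34.UnitaryClassNumber
import Summits.HodgeConjecture.HodgeCM.PerL34.CongruenceLattice

/-!
# `S(K_f) = ⊔_j Γ_j\X`: the adelic double quotient as a finite disjoint union of arithmetic quotients
(PerL v5 §1.2 l. 70, KERNEL, set level)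

PerL v5 l. 70: *"`S(K_f) := G_U(L₀)\(𝔹² × G_U(𝔸_{L₀,f})/K_f)`, a finite union of quotients `Γ_j\𝔹²` by the
congruence subgroups `Γ_j = G_U(L₀) ∩ g_jK_fg_j⁻¹`"*.  With `𝔹² = G_U(ℝ)/K_∞` this is the assertion that the
double quotient `G_U(L₀)\G_U(𝔸_{L₀})/(K_∞ × K_f)` is the DISJOINT UNION, over a set of representatives `g_j` of the
(finite, `UnitaryClassNumber`) class set `G_U(L₀)\G_U(𝔸_{L₀,f})/K_f`, of the arithmetic quotients
`Γ_j\G_U(ℝ)/K_∞`, `Γ_j := pr_∞(G_U(L₀) ∩ (G_U(ℝ) × g_jK_fg_j⁻¹))` — the `congruenceLattice` of the compact open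
subgroup `g_jK_fg_j⁻¹` (`CongruenceLattice`).  This file proves exactly that, for an ARBITRARY subgroup
`C ≤ G_U(ℝ)` in place of `K_∞` (pv06-g5's `HermSpace3.archK` is an admissible `C`):

* §1 is pure group theory: groups `A`, `B`, a subgroup `Q ≤ A × B` ("rational points"), `C ≤ A`, `K ≤ B`;
  the fibre lattices `Γ_b = {q_A | q ∈ Q, q_B ∈ bKb⁻¹}` (`fiberLattice`, characterised by `mem_fiberLattice_iff`),
  the finite parts `Q_B` (`sndPart`), the maps `Γ_b\A/C → Q\(A × B)/(C × K)`, `[a] ↦ [(a, b)]` (`fiberMap`: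
  well defined, injective, with disjoint images over `Q_B\B/K`-inequivalent `b`, jointly surjective), and the
  resulting bijection **`sigmaEquiv : (Σ j : Q_B\B/K, Γ_{rep j}\A/C) ≃ Q\(A × B)/(C × K)`** for any section `rep`
  of `B → Q_B\B/K`.  Everything is stated for ANY family `Γ` / subgroup `Q_B` satisfying the two membership
  characterisations, so that the application needs no transport along equalities of subgroups.
* §2 transports double quotients along a group isomorphism (`doubleCosetQuotientCongr`).
* §3 is the PerL case `A := Uinf L H = G_U(ℝ)`, `B := Ufin L H = G_U(𝔸_{L₀,f})`, `Q := G_U(L₀)` placed in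
  `A × B` by `splitEquiv`: `Q_B = ratFin L H` (`mem_ratFin_iff_exists`), `Γ_b = congruenceLattice L H (bK_fb⁻¹)`
  (`mem_congruenceLattice_conj_iff`), conjugates of compact open subgroups are compact open
  (`isCompact_conj_smul`, `isOpen_conj_smul`), the set `S(K_f; C) := G_U(L₀)\G_U(𝔸_{L₀})/(C × K_f)`
  (`ShimuraSet`) and the HEADLINES **`shimuraSetEquiv`** (the decomposition for any section of the class set),
  **`HodgeCM.HermSpace3.shimuraSet_decomposition`**: for `V : HermSpace3 L ι₁`, `[L:ℚ] ≠ 2`, `K_f` compact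
  open and any `C`, `S(K_f; C) ≃ Σ_{i ∈ ι} Γ_i\G_U(ℝ)/C` with `ι` FINITE and every `Γ_i` a DISCRETE COCOMPACT
  subgroup of `G_U(ℝ)` (rows #3, #4 of this seat).

Pure kernel mathematics over Mathlib + the package; nothing cited as hypothesis, nothing posited; closures are the
standard trio.
-/

set_option autoImplicit false

noncomputable section

open scoped Pointwise
open Literature.AlgebraicGeometry.ShimuraVarieties
open HodgeCM.Adelic HodgeCM.PerL34.AdelicUnitaryFactorisation

namespace HodgeCM.PerL34.Godement

/-! ## §1 Double quotients of a product group -/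

section Abstract

variable {A B : Type*} [Group A] [Group B] (Q : Subgroup (A × B)) (C : Subgroup A) (K : Subgroup B)

/-- The `B`-parts `Q_B ≤ B` of `Q ≤ A × B`. -/
def sndPart : Subgroup B := Q.map (MonoidHom.snd A B)

variable {Q} in
/-- (Ported verbatim from the HodgeCMPerL package; no docstring in the source.) -/
theorem mem_sndPart_iff {b : B} : b ∈ sndPart Q ↔ ∃ a : A, (a, b) ∈ Q := by
  constructor
  · rintro ⟨⟨a, b'⟩, hq, rfl⟩
    exact ⟨a, hq⟩
  · rintro ⟨a, h⟩
    exact ⟨(a, b), h, rfl⟩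

/-- The fibre lattice `Γ_b := {q_A | q ∈ Q, q_B ∈ b K b⁻¹} ≤ A` over `b : B`. -/
def fiberLattice (b : B) : Subgroup A :=
  (Q ⊓ K.comap (((MulAut.conj b)⁻¹).toMonoidHom.comp (MonoidHom.snd A B))).map (MonoidHom.fst A B)

variable {Q K} in
/-- (Ported verbatim from the HodgeCMPerL package; no docstring in the source.) -/
theorem mem_fiberLattice_iff {b : B} {a : A} :
    a ∈ fiberLattice Q K b ↔ ∃ x : B, (a, x) ∈ Q ∧ b⁻¹ * x * b ∈ K := by
  constructor
  · rintro ⟨⟨a', x⟩, ⟨hq, hk⟩, rfl⟩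
    exact ⟨x, hq, by simpa [Subgroup.mem_comap, MulAut.conj_inv_apply] using hk⟩
  · rintro ⟨x, hq, hk⟩
    exact ⟨(a, x), ⟨hq, by simpa [Subgroup.mem_comap, MulAut.conj_inv_apply] using hk⟩, rfl⟩

/-! ### The fibre maps, for any family `Γ` with the membership characterisation of `fiberLattice` -/

variable {Γ : B → Subgroup A} (hΓ : ∀ (b : B) (a : A), a ∈ Γ b ↔ ∃ x : B, (a, x) ∈ Q ∧ b⁻¹ * x * b ∈ K)

/-- The fibre map `Γ_b\A/C → Q\(A × B)/(C × K)`, `[a] ↦ [(a, b)]`. -/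
def fiberMap (b : B) :
    DoubleCoset.Quotient (Γ b : Set A) (C : Set A) →
      DoubleCoset.Quotient (Q : Set (A × B)) (C.prod K : Set (A × B)) :=
  Quotient.lift (fun a : A => DoubleCoset.mk Q (C.prod K) (a, b)) (by
    intro a a' h
    obtain ⟨γ, hγ, c, hc, rfl⟩ := DoubleCoset.rel_iff.mp h
    obtain ⟨x, hq, hx⟩ := (hΓ b γ).mp hγ
    refine (DoubleCoset.eq _ _ _ _).mpr
      ⟨(γ, x), hq, (c, b⁻¹ * x⁻¹ * b), Subgroup.mem_prod.mpr ⟨hc, ?_⟩, ?_⟩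
    · have hinv : b⁻¹ * x⁻¹ * b = (b⁻¹ * x * b)⁻¹ := by group
      rw [hinv]
      exact K.inv_mem hx
    · ext
      · simp
      · simp [mul_assoc])

/-- (Ported verbatim from the HodgeCMPerL package; no docstring in the source.) -/
@[simp] theorem fiberMap_mk (b : B) (a : A) :
    fiberMap Q C K hΓ b (DoubleCoset.mk (Γ b) C a) = DoubleCoset.mk Q (C.prod K) (a, b) := rfl

/-- Each fibre map is injective. -/
theorem fiberMap_injective (b : B) : Function.Injective (fiberMap Q C K hΓ b) := by
  intro x y hxy
  induction x using Quotient.inductionOn with | h a => ?_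
  induction y using Quotient.inductionOn with | h a' => ?_
  change DoubleCoset.mk Q (C.prod K) (a, b) = DoubleCoset.mk Q (C.prod K) (a', b) at hxy
  change DoubleCoset.mk (Γ b) C a = DoubleCoset.mk (Γ b) C a'
  obtain ⟨q, hq, ck, hck, h⟩ := (DoubleCoset.eq _ _ _ _).mp hxy
  obtain ⟨hc, hk⟩ := Subgroup.mem_prod.mp hck
  obtain ⟨h1, h2⟩ := Prod.ext_iff.mp h
  simp only [Prod.fst_mul, Prod.snd_mul] at h1 h2
  refine (DoubleCoset.eq _ _ _ _).mpr ⟨q.1, (hΓ b q.1).mpr ⟨q.2, hq, ?_⟩, ck.1, hc, h1⟩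
  have hconj : b⁻¹ * q.2 * b = ck.2⁻¹ := by
    calc b⁻¹ * q.2 * b = b⁻¹ * (q.2 * b * ck.2) * ck.2⁻¹ := by group
      _ = ck.2⁻¹ := by rw [← h2, inv_mul_cancel, one_mul]
  rw [hconj]
  exact K.inv_mem hk

/-- Points of `Q\(A × B)/(C × K)` with equal images have `Q_B\B/K`-equivalent `B`-components. -/
theorem mk_snd_eq_of_mk_eq {Qf : Subgroup B} (hQf : ∀ b : B, b ∈ Qf ↔ ∃ a : A, (a, b) ∈ Q)
    {a a' : A} {b b' : B}
    (h : DoubleCoset.mk Q (C.prod K) (a, b) = DoubleCoset.mk Q (C.prod K) (a', b')) :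
    DoubleCoset.mk Qf K b = DoubleCoset.mk Qf K b' := by
  obtain ⟨q, hq, ck, hck, h⟩ := (DoubleCoset.eq _ _ _ _).mp h
  obtain ⟨-, h2⟩ := Prod.ext_iff.mp h
  simp only [Prod.snd_mul] at h2
  exact (DoubleCoset.eq _ _ _ _).mpr ⟨q.2, (hQf q.2).mpr ⟨q.1, hq⟩, ck.2, (Subgroup.mem_prod.mp hck).2, h2⟩

/-- Every point of `Q\(A × B)/(C × K)` whose `B`-component is `Q_B\B/K`-equivalent to `b` is in the image of
the fibre map at `b`. -/
theorem exists_fiberMap_eq {Qf : Subgroup B} (hQf : ∀ b : B, b ∈ Qf ↔ ∃ a : A, (a, b) ∈ Q)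
    (a : A) {g b : B} (h : DoubleCoset.mk Qf K g = DoubleCoset.mk Qf K b) :
    ∃ x, fiberMap Q C K hΓ b x = DoubleCoset.mk Q (C.prod K) (a, g) := by
  obtain ⟨y, hy, k, hk, hb⟩ := (DoubleCoset.eq _ _ _ _).mp h
  obtain ⟨a₀, hq⟩ := (hQf y).mp hy
  refine ⟨DoubleCoset.mk _ _ (a₀ * a), ?_⟩
  rw [fiberMap_mk, eq_comm, DoubleCoset.eq]
  refine ⟨(a₀, y), hq, (1, k), Subgroup.mem_prod.mpr ⟨C.one_mem, hk⟩, ?_⟩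
  ext
  · simp
  · simp [hb]

variable {Qf : Subgroup B}

/-- The total map `(j, [a]) ↦ [(a, rep j)]` for a section `rep` of `B → Q_B\B/K`. -/
def sigmaMap (rep : DoubleCoset.Quotient (Qf : Set B) (K : Set B) → B) :
    (Σ j : DoubleCoset.Quotient (Qf : Set B) (K : Set B), DoubleCoset.Quotient (Γ (rep j) : Set A) (C : Set A)) →
      DoubleCoset.Quotient (Q : Set (A × B)) (C.prod K : Set (A × B)) :=
  fun p => fiberMap Q C K hΓ (rep p.1) p.2

/-- (Ported verbatim from the HodgeCMPerL package; no docstring in the source.) -/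
theorem sigmaMap_mk (rep : DoubleCoset.Quotient (Qf : Set B) (K : Set B) → B)
    (j : DoubleCoset.Quotient (Qf : Set B) (K : Set B)) (a : A) :
    sigmaMap Q C K hΓ (Qf := Qf) rep ⟨j, DoubleCoset.mk (Γ (rep j)) C a⟩ =
      DoubleCoset.mk Q (C.prod K) (a, rep j) := rfl

/-- **The decomposition is a bijection** for every section `rep` of the class set `Q_B\B/K`. -/
theorem sigmaMap_bijective (hQf : ∀ b : B, b ∈ Qf ↔ ∃ a : A, (a, b) ∈ Q)
    (rep : DoubleCoset.Quotient (Qf : Set B) (K : Set B) → B) (hrep : ∀ j, DoubleCoset.mk Qf K (rep j) = j) :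
    Function.Bijective (sigmaMap Q C K hΓ (Qf := Qf) rep) := by
  constructor
  · rintro ⟨j, x⟩ ⟨j', x'⟩ h
    have hj : j = j' := by
      induction x using Quotient.inductionOn with | h a => ?_
      induction x' using Quotient.inductionOn with | h a' => ?_
      have h' := mk_snd_eq_of_mk_eq Q C K hQf
        (h : DoubleCoset.mk Q (C.prod K) (a, rep j) = DoubleCoset.mk Q (C.prod K) (a', rep j'))
      rwa [hrep, hrep] at h'
    subst hj
    have hx : x = x' := fiberMap_injective Q C K hΓ (rep j) h
    subst hx
    rfl
  · intro s
    induction s using Quotient.inductionOn with | h p => ?_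
    obtain ⟨a, g⟩ := p
    obtain ⟨x, hx⟩ := exists_fiberMap_eq Q C K hΓ hQf a (g := g)
      (b := rep (DoubleCoset.mk Qf K g)) (by rw [hrep])
    exact ⟨⟨_, x⟩, hx⟩

/-- **`Q\(A × B)/(C × K) ≃ Σ_{j ∈ Q_B\B/K} Γ_{rep j}\A/C`** for any section `rep` of the class set. -/
def sigmaEquiv (hQf : ∀ b : B, b ∈ Qf ↔ ∃ a : A, (a, b) ∈ Q)
    (rep : DoubleCoset.Quotient (Qf : Set B) (K : Set B) → B) (hrep : ∀ j, DoubleCoset.mk Qf K (rep j) = j) :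
    (Σ j : DoubleCoset.Quotient (Qf : Set B) (K : Set B), DoubleCoset.Quotient (Γ (rep j) : Set A) (C : Set A)) ≃
      DoubleCoset.Quotient (Q : Set (A × B)) (C.prod K : Set (A × B)) :=
  Equiv.ofBijective _ (sigmaMap_bijective Q C K hΓ hQf rep hrep)

/-- The canonical instance: `Γ := fiberLattice Q K`, `Q_B := sndPart Q`, representatives `Quotient.out`. -/
def sigmaEquivOut :
    (Σ j : DoubleCoset.Quotient (sndPart Q : Set B) (K : Set B),
        DoubleCoset.Quotient (fiberLattice Q K j.out : Set A) (C : Set A)) ≃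
      DoubleCoset.Quotient (Q : Set (A × B)) (C.prod K : Set (A × B)) :=
  sigmaEquiv Q C K (Γ := fiberLattice Q K) (fun _ _ => mem_fiberLattice_iff) (Qf := sndPart Q)
    (fun _ => mem_sndPart_iff) Quotient.out (DoubleCoset.out_eq' _ _)

end Abstract

/-! ## §2 Transport of double quotients along a group isomorphism -/

section Transport

variable {G G' : Type*} [Group G] [Group G']

/-- `H\G/K ≃ Φ(H)\G'/Φ(K)` for a group isomorphism `Φ : G ≃* G'` (target subgroups given up to equality). -/
def doubleCosetQuotientCongr (Φ : G ≃* G') (H K : Subgroup G) (H' K' : Subgroup G')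
    (hH : H.map Φ.toMonoidHom = H') (hK : K.map Φ.toMonoidHom = K') :
    DoubleCoset.Quotient (H : Set G) (K : Set G) ≃ DoubleCoset.Quotient (H' : Set G') (K' : Set G') where
  toFun := Quotient.lift (fun g => DoubleCoset.mk H' K' (Φ g)) (by
    intro a b h
    obtain ⟨x, hx, y, hy, rfl⟩ := DoubleCoset.rel_iff.mp h
    refine (DoubleCoset.eq _ _ _ _).mpr ⟨Φ x, ?_, Φ y, ?_, by simp [map_mul]⟩
    · rw [← hH]; exact Subgroup.mem_map_of_mem _ hx
    · rw [← hK]; exact Subgroup.mem_map_of_mem _ hy)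
  invFun := Quotient.lift (fun g' => DoubleCoset.mk H K (Φ.symm g')) (by
    intro a b h
    obtain ⟨x, hx, y, hy, rfl⟩ := DoubleCoset.rel_iff.mp h
    rw [← hH] at hx
    rw [← hK] at hy
    obtain ⟨x₀, hx₀, rfl⟩ := Subgroup.mem_map.mp hx
    obtain ⟨y₀, hy₀, rfl⟩ := Subgroup.mem_map.mp hy
    exact (DoubleCoset.eq _ _ _ _).mpr ⟨x₀, hx₀, y₀, hy₀, by simp [map_mul]⟩)
  left_inv := by
    intro q
    induction q using Quotient.inductionOn with | h g => ?_
    change DoubleCoset.mk H K (Φ.symm (Φ g)) = DoubleCoset.mk H K g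
    rw [MulEquiv.symm_apply_apply]
  right_inv := by
    intro q
    induction q using Quotient.inductionOn with | h g => ?_
    change DoubleCoset.mk H' K' (Φ (Φ.symm g)) = DoubleCoset.mk H' K' g
    rw [MulEquiv.apply_symm_apply]

/-- (Ported verbatim from the HodgeCMPerL package; no docstring in the source.) -/
@[simp] theorem doubleCosetQuotientCongr_mk (Φ : G ≃* G') (H K : Subgroup G) (H' K' : Subgroup G')
    (hH : H.map Φ.toMonoidHom = H') (hK : K.map Φ.toMonoidHom = K') (g : G) :
    doubleCosetQuotientCongr Φ H K H' K' hH hK (DoubleCoset.mk H K g) = DoubleCoset.mk H' K' (Φ g) := rfl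

end Transport

/-! ## §3 The PerL case: `S(K_f; C) = G_U(L₀)\G_U(𝔸_{L₀})/(C × K_f)` -/

section Topology

variable {B : Type*} [Group B]

/-- (Ported verbatim from the HodgeCMPerL package; no docstring in the source.) -/
theorem mem_conj_smul_iff (K : Subgroup B) (b x : B) : x ∈ MulAut.conj b • K ↔ b⁻¹ * x * b ∈ K := by
  rw [Subgroup.mem_pointwise_smul_iff_inv_smul_mem, MulAut.smul_def, MulAut.conj_inv_apply]

/-- (Ported verbatim from the HodgeCMPerL package; no docstring in the source.) -/
theorem coe_conj_smul (K : Subgroup B) (b : B) :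
    ((MulAut.conj b • K : Subgroup B) : Set B) = (fun x => b * x * b⁻¹) '' (K : Set B) := by
  rw [Subgroup.coe_pointwise_smul, ← Set.image_smul]
  simp only [MulAut.smul_def, MulAut.conj_apply]

variable [TopologicalSpace B] [IsTopologicalGroup B]

/-- A conjugate of a compact subgroup is compact. -/
theorem isCompact_conj_smul (K : Subgroup B) (hK : IsCompact (K : Set B)) (b : B) :
    IsCompact ((MulAut.conj b • K : Subgroup B) : Set B) := by
  rw [coe_conj_smul]
  exact hK.image (by fun_prop)

/-- A conjugate of an open subgroup is open. -/
theorem isOpen_conj_smul (K : Subgroup B) (hK : IsOpen (K : Set B)) (b : B) :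
    IsOpen ((MulAut.conj b • K : Subgroup B) : Set B) := by
  rw [coe_conj_smul]
  have hf : (fun x : B => b * x * b⁻¹) = (fun x : B => x * b⁻¹) ∘ (fun x : B => b * x) := rfl
  rw [hf]
  exact ((isOpenMap_mul_right b⁻¹).comp (isOpenMap_mul_left b)) _ hK

end Topology

section PerL

variable (L : CMField) {n : Type} [Fintype n] [DecidableEq n] (H : Matrix n n L)

/-- `G_U(L₀)` placed inside `G_U(ℝ) × G_U(𝔸_{L₀,f})` by `splitEquiv`. -/
def ratProd : Subgroup (Uinf L H × Ufin L H) :=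
  (adelicUnitaryRat L H).map (splitEquiv L H).toMulEquiv.toMonoidHom

/-- (Ported verbatim from the HodgeCMPerL package; no docstring in the source.) -/
theorem mem_ratProd_iff (p : Uinf L H × Ufin L H) :
    p ∈ ratProd L H ↔ ∃ γ ∈ adelicUnitaryRat L H, splitEquiv L H γ = p :=
  Subgroup.mem_map

/-- `(ratProd)_f = ratFin`: the finite parts of the rational points. -/
theorem mem_ratFin_iff_exists (b : Ufin L H) : b ∈ ratFin L H ↔ ∃ a : Uinf L H, (a, b) ∈ ratProd L H := by
  constructor
  · rintro ⟨γ, hγ, rfl⟩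
    exact ⟨(splitEquiv L H γ).1, (mem_ratProd_iff L H _).mpr ⟨γ, hγ, rfl⟩⟩
  · rintro ⟨a, h⟩
    obtain ⟨γ, hγ, hγp⟩ := (mem_ratProd_iff L H _).mp h
    exact ⟨γ, hγ, by rw [finProj_apply, hγp]⟩

/-- `Γ_b = congruenceLattice (bK_fb⁻¹)`: the fibre lattices of the rational points are the adelic congruence
lattices of the conjugate levels. -/
theorem mem_congruenceLattice_conj_iff (Kf : Subgroup (Ufin L H)) (b : Ufin L H) (a : Uinf L H) :
    a ∈ congruenceLattice L H (MulAut.conj b • Kf) ↔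
      ∃ x : Ufin L H, (a, x) ∈ ratProd L H ∧ b⁻¹ * x * b ∈ Kf := by
  rw [mem_congruenceLattice_iff]
  constructor
  · rintro ⟨γ, hγ, hK, hγa⟩
    refine ⟨(splitEquiv L H γ).2, (mem_ratProd_iff L H _).mpr ⟨γ, hγ, Prod.ext hγa rfl⟩, ?_⟩
    exact (mem_conj_smul_iff Kf b _).mp hK
  · rintro ⟨x, hq, hx⟩
    obtain ⟨γ, hγ, hγp⟩ := (mem_ratProd_iff L H _).mp hq
    refine ⟨γ, hγ, ?_, congrArg Prod.fst hγp⟩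
    rw [mem_conj_smul_iff, show (splitEquiv L H γ).2 = x from congrArg Prod.snd hγp]
    exact hx

/-- (Ported verbatim from the HodgeCMPerL package; no docstring in the source.) -/
theorem fiberLattice_ratProd (Kf : Subgroup (Ufin L H)) (b : Ufin L H) :
    fiberLattice (ratProd L H) Kf b = congruenceLattice L H (MulAut.conj b • Kf) := by
  ext a
  rw [mem_fiberLattice_iff, mem_congruenceLattice_conj_iff]

/-- (Ported verbatim from the HodgeCMPerL package; no docstring in the source.) -/
theorem sndPart_ratProd : sndPart (ratProd L H) = ratFin L H := by
  ext b
  rw [mem_sndPart_iff, mem_ratFin_iff_exists]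

/-- The adelic level `C × K_f ≤ G_U(𝔸_{L₀})` (pulled back along `splitEquiv`). -/
def adelicLevel (C : Subgroup (Uinf L H)) (Kf : Subgroup (Ufin L H)) : Subgroup (adelicUnitaryGroup L H) :=
  (C.prod Kf).comap (splitEquiv L H).toMulEquiv.toMonoidHom

/-- (Ported verbatim from the HodgeCMPerL package; no docstring in the source.) -/
theorem mem_adelicLevel_iff (C : Subgroup (Uinf L H)) (Kf : Subgroup (Ufin L H)) (g : adelicUnitaryGroup L H) :
    g ∈ adelicLevel L H C Kf ↔ (splitEquiv L H g).1 ∈ C ∧ (splitEquiv L H g).2 ∈ Kf :=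
  Subgroup.mem_prod

/-- (Ported verbatim from the HodgeCMPerL package; no docstring in the source.) -/
theorem map_adelicLevel (C : Subgroup (Uinf L H)) (Kf : Subgroup (Ufin L H)) :
    (adelicLevel L H C Kf).map (splitEquiv L H).toMulEquiv.toMonoidHom = C.prod Kf :=
  Subgroup.map_comap_eq_self_of_surjective (splitEquiv L H).surjective _

/-- **`S(K_f; C) := G_U(L₀)\G_U(𝔸_{L₀})/(C × K_f)`** — PerL's `S(K_f)` for `C = K_∞` (`G_U(ℝ)/K_∞ = 𝔹²`), as a set. -/
abbrev ShimuraSet (C : Subgroup (Uinf L H)) (Kf : Subgroup (Ufin L H)) : Type _ :=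
  DoubleCoset.Quotient (adelicUnitaryRat L H : Set (adelicUnitaryGroup L H))
    (adelicLevel L H C Kf : Set (adelicUnitaryGroup L H))

/-- `S(K_f; C) ≃ G_U(L₀)\(G_U(ℝ) × G_U(𝔸_{L₀,f}))/(C × K_f)` (transport along `splitEquiv`). -/
def shimuraSetEquivProd (C : Subgroup (Uinf L H)) (Kf : Subgroup (Ufin L H)) :
    ShimuraSet L H C Kf ≃
      DoubleCoset.Quotient (ratProd L H : Set (Uinf L H × Ufin L H)) (C.prod Kf : Set (Uinf L H × Ufin L H)) :=
  doubleCosetQuotientCongr (splitEquiv L H).toMulEquiv _ _ _ _ rfl (map_adelicLevel L H C Kf)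

/-- **PerL v5 l. 70 (KERNEL, set level): `S(K_f; C) ≃ Σ_{j ∈ G_U(L₀)\G_U(𝔸_{L₀,f})/K_f} Γ_j\G_U(ℝ)/C`** with
`Γ_j = congruenceLattice L H (g_j K_f g_j⁻¹)` for ANY choice of representatives `g_j = rep j` of the class set. -/
def shimuraSetEquiv (C : Subgroup (Uinf L H)) (Kf : Subgroup (Ufin L H))
    (rep : DoubleCoset.Quotient (ratFin L H : Set (Ufin L H)) (Kf : Set (Ufin L H)) → Ufin L H)
    (hrep : ∀ j, DoubleCoset.mk (ratFin L H) Kf (rep j) = j) :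
    ShimuraSet L H C Kf ≃
      Σ j : DoubleCoset.Quotient (ratFin L H : Set (Ufin L H)) (Kf : Set (Ufin L H)),
        DoubleCoset.Quotient (congruenceLattice L H (MulAut.conj (rep j) • Kf) : Set (Uinf L H))
          (C : Set (Uinf L H)) :=
  (shimuraSetEquivProd L H C Kf).trans
    (sigmaEquiv (ratProd L H) C Kf (Γ := fun b => congruenceLattice L H (MulAut.conj b • Kf))
      (fun b a => mem_congruenceLattice_conj_iff L H Kf b a) (Qf := ratFin L H)
      (fun b => mem_ratFin_iff_exists L H b) rep hrep).symm

/-- The decomposition with the canonical representatives `Quotient.out`. -/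
def shimuraSetEquivOut (C : Subgroup (Uinf L H)) (Kf : Subgroup (Ufin L H)) :
    ShimuraSet L H C Kf ≃
      Σ j : DoubleCoset.Quotient (ratFin L H : Set (Ufin L H)) (Kf : Set (Ufin L H)),
        DoubleCoset.Quotient (congruenceLattice L H (MulAut.conj j.out • Kf) : Set (Uinf L H))
          (C : Set (Uinf L H)) :=
  shimuraSetEquiv L H C Kf Quotient.out (DoubleCoset.out_eq' _ _)

/-- The class of `g ∈ G_U(𝔸_{L₀})` lies in the `j`-th piece, `j` = the class of its finite part. -/
theorem shimuraSetEquiv_symm_apply (C : Subgroup (Uinf L H)) (Kf : Subgroup (Ufin L H))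
    (rep : DoubleCoset.Quotient (ratFin L H : Set (Ufin L H)) (Kf : Set (Ufin L H)) → Ufin L H)
    (hrep : ∀ j, DoubleCoset.mk (ratFin L H) Kf (rep j) = j)
    (j : DoubleCoset.Quotient (ratFin L H : Set (Ufin L H)) (Kf : Set (Ufin L H))) (a : Uinf L H) :
    (shimuraSetEquiv L H C Kf rep hrep).symm ⟨j, DoubleCoset.mk _ _ a⟩ =
      DoubleCoset.mk _ _ ((splitEquiv L H).symm (a, rep j)) :=
  rfl

end PerL

/-! ### Headlines for `HermSpace3` -/


-- port_pkg: scope closed for this part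
end HodgeCM.PerL34.Godement
end
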